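import Mathlib
import Literature.MathematicalPhysics.QuantumFieldTheory.Balaban1983to89.B9Thm34Ext

/-!
# `Balaban1983to89.B9Ineq347` — "the global inequalities (3.47) are consequences of the local ones (3.42) and Lemma 2.1" (B9 p. 398), kernel-checked for the first entry

T. Bałaban, *Propagators for lattice gauge theories in a background field*, Commun. Math. Phys. **99**, 389–434
(1985) [Balaban1985BackgroundPropagators] (cell paper B9; PDF held `paper:balaban1985-cmp99-background-propagators`,
journal page = PDF page + 388).  Sibling of `…Balaban1983to89.B9` (UNTOUCHED: Theorem 3.1 = `B9.Thm31Printed`,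
(3.42)/(3.46)/(3.47) = `B9.Ineq342_346_347` over the abstract carrier `Loc`) and of `…B9Thm34Ext` (whose transport
`toB6 : B9.Geometry → B6.Geometry` and function-level reading of (3.42) are reused), using the block-majorant calculus of
[4] = [Balaban1984PropagatorsII] typed by unit pv08 (`…B6RandomWalk`: `HasMajorant`, `blockPiece`, `Ineq260/261`).

CITATION HEADER (lean-in-tree rule 2026-08-18).  This module is a KERNEL-CHECKED BOOKKEEPING STEP of the published
paper [Balaban1985BackgroundPropagators], p. 398 [PDF 10], the two sentences after Theorem 3.1, verbatim:

> *"Next, the choice of powers L^jη is conventional also. Using Lemma 2.1 in [4] we may replace the factor (L^jη)^α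
> by (L^jη)^β(L^{j′}η)^γ with β + γ = α, j, j′ are indices of localizations.  It is easy to see that the global
> inequalities (3.47) are consequences of the local ones (3.42) and Lemma 2.1."*

where (3.47) reads (p. 398, verbatim) *"|G′(U)λ|_{(2+γ)}, |∇_UG′(U)λ|_{(1+γ)}, |G′(U)∇*_Uλ|_{(1+γ)}, |∇_UG′(U)λ|_{(γ)}
[sic: Δ_UG′(U)λ, census G-B9-01] ≦ B₀|λ|_{(γ)} (3.47) for γ in a fixed compact subset of real numbers, e.g. for
γ ∈ [−4, 4]"* — the print's B₀ here is ONE constant "dependent on d and L only" (Theorem 3.1, p. 397) for γ in the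
compact set; this module makes it explicit and WRITES IT B₀(γ) := B₀c₁(1−α)L^{|γ|} ≤ B₀c₁(1−α)L⁴ on [−4, 4] (the
notation B₀(γ) below is the module's, not the print's) —, |·|_{(γ)} being the scaled supremum norm (3.41) p. 397
(weight (L^jη)^γ on the j-th region), (3.42) reads (p. 397; left members abridged here from the printed
|(G′(U)λ)(x)|, |(∇_UG′(U)λ)(x)|, |(G′(U)∇*_Uλ)(x)|, |(Δ_UG′(U)λ)(x)|) *"… ≦ B₀[(L^jη)², L^jη, L^jη, 1]e^{−δ₀d(y,y′)}|λ|
for x ∈ Δ(y), y ∈ Λ_j, supp λ ⊂ Δ(y′);"* with *"Here y, y′ ∈ 𝔅 = ⋃_{j=0}^{k} Λ_j"* the sentence before Theorem 3.1, and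
"Lemma 2.1 in [4]" = [Balaban1984PropagatorsII] p. 234: (2.60) *"e^{−αδ₀d(y,y′)} ≦ e^{−αδ₀RM max{|j−j′|−1,0}},
y ∈ Λ_j, y′ ∈ Λ_{j′}"*, (2.61) *"sup_{y∈𝔅} Σ_{y′∈𝔅} e^{−αδ₀d(y,y′)} ≦ c₁(α)"* (typed `B6RandomWalk.Ineq260`, `Ineq261`).

WHAT IS REPRODUCED (0 sorry) — the FIRST entry of (3.47) from the FIRST entry of (3.42), with the constant B₀(γ) and
the size condition the print leaves inside "It is easy to see" made EXPLICIT: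
* `ScaleTransfer` — the typed form of *"we may replace the factor (L^jη)^α by (L^jη)^β(L^{j′}η)^γ"*: for a weight
  w ≥ 0 on 𝔅 (w(y) = (L^jη)^γ), e^{−αδ₀d(y,y′)}w(y′) ≦ C·w(y).
* `scaleTransfer_of_260` — its derivation from (2.60): if e^{−αδ₀d(y,y′)} ≦ q^{n(y,y′)−1} (q = e^{−αδ₀RM},
  n = |j − j′|; this IS (2.60)) and w(y′) ≦ Λ^{n(y,y′)}w(y) (Λ = L^{|γ|} ≧ 1: one factor L^{|γ|} per scale step), then
  `ScaleTransfer` holds with C = Λ PROVIDED Λq ≦ 1, i.e. L^{|γ|}e^{−αδ₀RM} ≦ 1 ⟺ RM ≧ |γ|ln L/(αδ₀) — the LOCATED size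
  condition (uniform for γ in a compact set, which is why the print restricts γ to one; it is of the kind (2.59) of [4]).
* `glob347_entry1_of_342` — **(3.42)₁ ⇒ (3.47)₁**: if G′ has the (3.42)₁ block majorant B₀P(y)e^{−δ₀d(y,y′)} (P(y) =
  (L^jη)², any P ≥ 0), (2.61) holds at the exponent 1 − α and `ScaleTransfer` at the exponent α with constant C, then for
  every λ with |λ(x)| ≦ w(y)N on Δ(y) (i.e. |λ|_{(γ)} ≦ N): |(G′λ)(x)| ≦ B₀c₁(1−α)C·P(y)w(y)·N for x ∈ Δ(y) — i.e.
  |G′λ|_{(2+γ)} ≦ B₀(γ)|λ|_{(γ)} with **B₀(γ) = B₀c₁(1−α)L^{|γ|}** (any 0 < α < 1 admissible in Lemma 2.1).  Proof as the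
  print indicates: λ = Σ_{y′}Δ(y′)λ ([4] (2.52)), (3.42)₁ block by block, e^{−δ₀d} = e^{−(1−α)δ₀d}·e^{−αδ₀d}, the second
  factor carries the weight from y′ to y (`ScaleTransfer`), the first is summed by (2.61).
* `glob347_entry1_explicit` — the two previous items chained: the constant B₀c₁(1−α)Λ under Λq ≦ 1.

WHAT IS NOT REPRODUCED: (i) the other three entries of (3.47) (identical bookkeeping with P(y) = L^jη, L^jη, 1 once
∇_UG′, G′∇*_U, Δ_UG′ are read as operators between the appropriate function spaces — pv08's calculus is typed for
endomorphisms of one space, cf. `…B9Thm34Ext`); (ii) (2.60)/(2.61) for THIS geometry (hypotheses `h260`-shaped /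
`h261`, as in `…B9Thm34Ext`); (iii) the identification of the typed weight w with (L^jη)^γ for REAL γ (kept abstract:
w ≥ 0 with the one-step ratio Λ; for w(y) = (L^{j(y)}η)^γ one has w(y′) = L^{γ(j′−j)}w(y) ≦ L^{|γ||j−j′|}w(y), L ≧ 1);
(iv) the link to the `Loc`-level Prop `B9.Ineq342_346_347` / the residual hypotheses `B9FromB6.ResidualGAGlobAtOne`,
`ResidualGpAtOne` ((3.47) at U = 1, census G-A1-1 (b)) — those abstract carriers are not tied to functions X → ℝ; this
module discharges the (3.47)₁-from-(3.42)₁ implication at the function level and the dictionary is this docstring.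
NOTHING of the series' end-statement is asserted; value = kernel-checked bookkeeping of a printed "It is easy to see",
NOT summit progress.  Unit `b2b-balaban-b09-g2` (paper sub-cell B09, gen 2), SHARPEN pass 2 of node T06.1; cell row
C-B9-16.  v1.1 (`b2b-balaban-b09-g6`, docstring-only, declarations byte-identical): header quotation of (3.47) now
with the printed constant B₀ (the token «(γ)» had been inserted into the quotation; cross-read G-pv10-3), the module's
notation B₀(γ) declared as such, and the (3.42) quotation marked abridged with «y′ ∈ 𝔅» attributed to its own sentence.
-/

namespace Literature.MathematicalPhysics.QuantumFieldTheory.Balaban1983to89.B9Ineq347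

open Literature.MathematicalPhysics.QuantumFieldTheory.Balaban1983to89

/-! ## "we may replace the factor (L^jη)^α by (L^jη)^β(L^{j′}η)^γ" (p. 398) -/

/-- The scale-transfer inequality behind *"Using Lemma 2.1 in [4] we may replace the factor (L^jη)^α by
(L^jη)^β(L^{j′}η)^γ with β + γ = α"* (p. 398 [PDF 10]): for a weight w on 𝔅 (w(y) = (L^jη)^γ, y ∈ Λ_j) and an
exponent α, e^{−αδ₀d(y,y′)}w(y′) ≤ C·w(y) for all y, y′ ∈ 𝔅. [cite: Balaban1985BackgroundPropagators, p.398 remark after (3.47)] -/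
def ScaleTransfer (g : B9.Geometry) (δ₀ α C : ℝ) (w : g.Site → ℝ) : Prop :=
  ∀ y y' : g.Site, Real.exp (-(α * δ₀ * g.dist y y')) * w y' ≤ C * w y

/-- Elementary: for 0 ≤ q, 1 ≤ Λ, Λq ≤ 1 and every n, q^{n−1}Λⁿ ≤ Λ (n − 1 in ℕ, so n = 0 gives 1 ≤ Λ). [folklore] -/
theorem pow_pred_mul_pow_le (q Λ : ℝ) (hq : 0 ≤ q) (hΛ : 1 ≤ Λ) (hqΛ : Λ * q ≤ 1) (n : ℕ) :
    q ^ (n - 1) * Λ ^ n ≤ Λ := by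
  cases n with
  | zero => simpa using hΛ
  | succ m =>
      have hΛ0 : 0 ≤ Λ := le_trans zero_le_one hΛ
      have h1 : (Λ * q) ^ m ≤ 1 := pow_le_one₀ (mul_nonneg hΛ0 hq) hqΛ
      calc q ^ (m + 1 - 1) * Λ ^ (m + 1) = Λ * (Λ * q) ^ m := by
            rw [Nat.add_sub_cancel, pow_succ, mul_pow]; ring
        _ ≤ Λ * 1 := mul_le_mul_of_nonneg_left h1 hΛ0
        _ = Λ := mul_one Λ

/-- **(2.60) ⇒ the scale transfer.**  Hypotheses: `h260` = (2.60) of [4] in the form e^{−αδ₀d(y,y′)} ≤ q^{n(y,y′)−1}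
with q = e^{−αδ₀RM} ≥ 0 and n(y,y′) = |j − j′| (any ℕ-valued n); `hratio` = the weight grows by at most a factor
Λ ≥ 1 per scale step, w(y′) ≤ Λ^{n(y,y′)}w(y) (for w(y) = (L^jη)^γ: Λ = L^{|γ|}); `hsmall` = Λq ≤ 1, i.e.
L^{|γ|}e^{−αδ₀RM} ≤ 1 — the located size condition RM ≥ |γ|ln L/(αδ₀).  Conclusion: `ScaleTransfer` with C = Λ.
[cite: Balaban1985BackgroundPropagators, p.398 remark after (3.47); Balaban1984PropagatorsII, (2.60) p.234] -/
theorem scaleTransfer_of_260 (g : B9.Geometry) (δ₀ α q Λ : ℝ) (w : g.Site → ℝ) (n : g.Site → g.Site → ℕ)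
    (hq : 0 ≤ q) (hΛ : 1 ≤ Λ) (hsmall : Λ * q ≤ 1) (hw : ∀ y, 0 ≤ w y)
    (h260 : ∀ y y' : g.Site, Real.exp (-(α * δ₀ * g.dist y y')) ≤ q ^ (n y y' - 1))
    (hratio : ∀ y y' : g.Site, w y' ≤ Λ ^ n y y' * w y) :
    ScaleTransfer g δ₀ α Λ w := by
  intro y y'
  have hqn : 0 ≤ q ^ (n y y' - 1) := pow_nonneg hq _
  calc Real.exp (-(α * δ₀ * g.dist y y')) * w y'
      ≤ q ^ (n y y' - 1) * (Λ ^ n y y' * w y) :=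
        mul_le_mul (h260 y y') (hratio y y') (hw y') hqn
    _ = (q ^ (n y y' - 1) * Λ ^ n y y') * w y := by ring
    _ ≤ Λ * w y := mul_le_mul_of_nonneg_right (pow_pred_mul_pow_le q Λ hq hΛ hsmall _) (hw y)

/-! ## (3.42)₁ ⇒ (3.47)₁ -/

section Glob

variable {g : B9.Geometry} [Fintype g.Site] {R : ℝ} {H : Prop} {X : Type}

/-- **"It is easy to see that the global inequalities (3.47) are consequences of the local ones (3.42) and Lemma 2.1"
— first entry, constants explicit.**  If G′ has the (3.42)₁ block majorant B₀P(y)e^{−δ₀d(y,y′)} (x ∈ Δ(y) ⟺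
`blk x = y`; P(y) = (L^jη)², any P ≥ 0), Lemma 2.1 (2.61) of [4] holds at the exponent 1 − α and the scale transfer at
the exponent α with constant C ≥ 0, then for every λ with |λ(x)| ≤ w(y)N for x ∈ Δ(y) (N ≥ 0, i.e. |λ|_{(γ)} ≤ N for
w = (L^jη)^γ):  |(G′λ)(x)| ≤ B₀c₁(1−α)C·P(y)w(y)N for x ∈ Δ(y) — i.e. |G′λ|_{(2+γ)} ≤ B₀(γ)|λ|_{(γ)} with
B₀(γ) = B₀c₁(1−α)C.  Route: λ = Σ_{y′}Δ(y′)λ, (3.42)₁ block by block, e^{−δ₀d} = e^{−(1−α)δ₀d}e^{−αδ₀d}, scale transfer,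
(2.61). [cite: Balaban1985BackgroundPropagators, (3.42) p.397 + (3.47) and the sentence after it p.398] -/
theorem glob347_entry1_of_342 (blk : X → g.Site) (d : ℕ) (δ₀ α B₀ C N : ℝ) (P w : g.Site → ℝ)
    (hB₀ : 0 ≤ B₀) (hP : ∀ y, 0 ≤ P y) (hw : ∀ y, 0 ≤ w y) (hN : 0 ≤ N)
    (h261 : B6RandomWalk.Ineq261 d (B9Thm34Ext.toB6 g R H) δ₀ (1 - α)) (hST : ScaleTransfer g δ₀ α C w)
    {G : Module.End ℝ (X → ℝ)}
    (h342 : B6RandomWalk.HasMajorant (g := B9Thm34Ext.toB6 g R H) blk G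
      (fun a b => B₀ * P a * Real.exp (-(δ₀ * g.dist a b))))
    (μ : X → ℝ) (hμ : ∀ x, |μ x| ≤ w (blk x) * N) (x : X) :
    |G μ x| ≤ B₀ * B6.c1 d δ₀ (1 - α) * C * P (blk x) * w (blk x) * N := by
  -- (3.42)₁ on each block piece Δ(y′)λ
  have hpiece : ∀ y' : g.Site,
      |G (B6RandomWalk.blockPiece (g := B9Thm34Ext.toB6 g R H) blk y' μ) x| ≤
        B₀ * P (blk x) * Real.exp (-(δ₀ * g.dist (blk x) y')) * (w y' * N) := fun y' =>
    h342 y' _ _ (B6RandomWalk.blockSupp_blockPiece (g := B9Thm34Ext.toB6 g R H) blk μ y' (w y' * N)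
      (mul_nonneg (hw _) hN) (fun x' hx' => by rw [← hx']; exact hμ x')) x
  -- λ = Σ_{y′} Δ(y′)λ and linearity
  have hsum : G μ x = ∑ y' : g.Site, G (B6RandomWalk.blockPiece (g := B9Thm34Ext.toB6 g R H) blk y' μ) x := by
    conv_lhs => rw [← B6RandomWalk.sum_blockPiece (g := B9Thm34Ext.toB6 g R H) blk μ, map_sum, Finset.sum_apply]
    rfl
  -- splitting of the exponential
  have hsplit : ∀ y' : g.Site, Real.exp (-(δ₀ * g.dist (blk x) y')) =
      Real.exp (-((1 - α) * δ₀ * g.dist (blk x) y')) * Real.exp (-(α * δ₀ * g.dist (blk x) y')) := by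
    intro y'
    rw [← Real.exp_add]
    congr 1
    ring
  have hK : 0 ≤ B₀ * P (blk x) * N := mul_nonneg (mul_nonneg hB₀ (hP _)) hN
  calc |G μ x| = |∑ y' : g.Site, G (B6RandomWalk.blockPiece (g := B9Thm34Ext.toB6 g R H) blk y' μ) x| := by rw [hsum]
    _ ≤ ∑ y' : g.Site, |G (B6RandomWalk.blockPiece (g := B9Thm34Ext.toB6 g R H) blk y' μ) x| :=
        Finset.abs_sum_le_sum_abs _ _
    _ ≤ ∑ y' : g.Site, B₀ * P (blk x) * Real.exp (-(δ₀ * g.dist (blk x) y')) * (w y' * N) :=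
        Finset.sum_le_sum fun y' _ => hpiece y'
    _ = B₀ * P (blk x) * N * ∑ y' : g.Site, Real.exp (-((1 - α) * δ₀ * g.dist (blk x) y')) *
          (Real.exp (-(α * δ₀ * g.dist (blk x) y')) * w y') := by
        rw [Finset.mul_sum]
        refine Finset.sum_congr rfl fun y' _ => ?_
        rw [hsplit y']
        ring
    _ ≤ B₀ * P (blk x) * N * ∑ y' : g.Site, Real.exp (-((1 - α) * δ₀ * g.dist (blk x) y')) * (C * w (blk x)) := by
        refine mul_le_mul_of_nonneg_left (Finset.sum_le_sum fun y' _ => ?_) hK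
        exact mul_le_mul_of_nonneg_left (hST (blk x) y') (Real.exp_nonneg _)
    _ = B₀ * P (blk x) * N * (C * w (blk x)) *
          ∑ y' : g.Site, Real.exp (-((1 - α) * δ₀ * g.dist (blk x) y')) := by
        rw [← Finset.sum_mul]
        ring
    _ ≤ B₀ * P (blk x) * N * (C * w (blk x)) * B6.c1 d δ₀ (1 - α) := by
        refine mul_le_mul_of_nonneg_left (h261 (blk x)) ?_
        have hC : 0 ≤ C * w (blk x) := by
          -- C·w(y) ≥ e^{…}·w(y) ≥ 0 from the scale transfer at y′ = y
          exact le_trans (mul_nonneg (Real.exp_nonneg _) (hw _)) (hST (blk x) (blk x))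
        exact mul_nonneg hK hC
    _ = B₀ * B6.c1 d δ₀ (1 - α) * C * P (blk x) * w (blk x) * N := by ring

/-- **(3.47)₁ with the located size condition** — `glob347_entry1_of_342` ∘ `scaleTransfer_of_260`: under (3.42)₁,
(2.61) at 1 − α, (2.60) in the form e^{−αδ₀d} ≤ q^{n−1} (q = e^{−αδ₀RM}), the one-step weight ratio Λ (= L^{|γ|}) and
Λq ≤ 1 (RM ≥ |γ|ln L/(αδ₀)):  |(G′λ)(x)| ≤ B₀c₁(1−α)Λ·P(y)w(y)|λ|_{(γ)}, i.e. B₀(γ) = B₀c₁(1−α)L^{|γ|}.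
[cite: Balaban1985BackgroundPropagators, (3.47) p.398; Balaban1984PropagatorsII, Lemma 2.1 (2.60)–(2.61) p.234] -/
theorem glob347_entry1_explicit (blk : X → g.Site) (d : ℕ) (δ₀ α B₀ q Λ N : ℝ) (P w : g.Site → ℝ)
    (n : g.Site → g.Site → ℕ)
    (hB₀ : 0 ≤ B₀) (hP : ∀ y, 0 ≤ P y) (hw : ∀ y, 0 ≤ w y) (hN : 0 ≤ N) (hq : 0 ≤ q) (hΛ : 1 ≤ Λ)
    (hsmall : Λ * q ≤ 1)
    (h260 : ∀ y y' : g.Site, Real.exp (-(α * δ₀ * g.dist y y')) ≤ q ^ (n y y' - 1))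
    (hratio : ∀ y y' : g.Site, w y' ≤ Λ ^ n y y' * w y)
    (h261 : B6RandomWalk.Ineq261 d (B9Thm34Ext.toB6 g R H) δ₀ (1 - α))
    {G : Module.End ℝ (X → ℝ)}
    (h342 : B6RandomWalk.HasMajorant (g := B9Thm34Ext.toB6 g R H) blk G
      (fun a b => B₀ * P a * Real.exp (-(δ₀ * g.dist a b))))
    (μ : X → ℝ) (hμ : ∀ x, |μ x| ≤ w (blk x) * N) (x : X) :
    |G μ x| ≤ B₀ * B6.c1 d δ₀ (1 - α) * Λ * P (blk x) * w (blk x) * N :=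
  glob347_entry1_of_342 (R := R) (H := H) blk d δ₀ α B₀ Λ N P w hB₀ hP hw hN h261
    (scaleTransfer_of_260 g δ₀ α q Λ w n hq hΛ hsmall hw h260 hratio) h342 μ hμ x

end Glob

/-! ## (2.60) of [4] in the form used above -/

section From260

variable (g : B9.Geometry) [Fintype g.Site] (R : ℝ) (H : Prop)

/-- Dictionary to pv08's typed (2.60) (`B6RandomWalk.Ineq260 (toB6 g R H) δ₀ α`, exponent αδ₀RM·max{|j−j′|−1, 0}):
the hypothesis `h260` of `scaleTransfer_of_260` has the shape e^{−αδ₀d} ≤ q^{m} with q = e^{−a}, a = αδ₀RM and the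
natural number m = n − 1 = max{|j−j′|−1, 0}; this lemma is the one-line passage between the two displayed shapes,
e^{−a·m} = (e^{−a})^m, for a given pair y, y′ (the identification of the real max{|j−j′|−1,0} with the ℕ-valued n − 1
is left to the instantiating seat). [cite: Balaban1984PropagatorsII, (2.60) p.234] -/
theorem h260_of_Ineq260_shape (a t : ℝ) (m : ℕ) (h : Real.exp (-t) ≤ Real.exp (-(a * (m : ℝ)))) :
    Real.exp (-t) ≤ Real.exp (-a) ^ m := by
  have hm : Real.exp (-(a * (m : ℝ))) = Real.exp (-a) ^ m := by
    rw [← Real.exp_nat_mul]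
    congr 1
    ring
  rw [← hm]
  exact h

end From260

end Literature.MathematicalPhysics.QuantumFieldTheory.Balaban1983to89.B9Ineq347
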